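import Literature.NumberTheory.EllipticCurves.Kriz2021.AnticyclotomicPAdicLFunction
import Literature.NumberTheory.QuadraticFields.KroneckerSplitting
import HarnessLib

/-!
# Kriz 2021 (Ann. of Math. Studies 212), Thm. 9.10 at a non-split prime — companion PROOFS for
# `Kriz2021/AnticyclotomicPAdicLFunction.lean`: `Ξ_p(w, χ̌) ≠ 0` from Hasse's bound, and the `p = 2`,
# `4 ∣ d_K` specialisation of the named fact (`2` ramified ⟹ exactly one prime of `𝓞 K` above `2`)

Cell `bsd-goldfeld`, seat `bsd-goldfeld-ty-2`. THEOREMS ONLY (no definition, no fact, no `sorry`): the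
two deductions used in the module docstring of the companion file — (T3)/(T4): the factor
`Ξ_p(w, χ̌) = 1 − a_p χ̌⁻¹(𝔭)(p−1)/p − 1/p²` (ramified) / `1 − a_p² χ̌⁻¹(p)(p−1)/(p+1) − 1/p²` (inert) of
Kriz's Prop. 8.11 / Thm. 8.14 / Thm. 9.10 never vanishes on `Σ` in weight `2`, because `‖χ̌⁻¹(𝔭)‖ = 1/p`
(resp. `1/p²`) there and `|a_p(E)| ≤ 2√p < p + 1` (Hasse, tree `hasse_bound_holds`) — and the decomposition
law at `2` in a quadratic field in the ramified case `4 ∣ d_K` (Marcus, Ch. 3 Thm. 25; Dedekind–Kummer via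
the tree's `QuadraticFields.KroneckerSplitting`), which turns the consumer's hypothesis `4 ∣ d_K` into the
fact's "`p = 2` is inert or ramified in `K`".

## References
* [Kriz2021] D. Kriz, Ann. of Math. Studies 212 (2021), Prop. 8.11 (p0214), Thm. 9.10 (p0227), §1.3 (p0032).
* [SilvermanAEC2009] Thm. V.1.1 (Hasse). [Marcus2018] Ch. 3, Thm. 25.
-/

noncomputable section

open scoped Classical
open Polynomial NumberField UniqueFactorizationMonoid
open Literature.NumberTheory.GaloisRepresentations
open Literature.NumberTheory.EllipticCurves.ModularForms
open Literature.NumberTheory.QuadraticFields.Quadratic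

namespace Literature.NumberTheory.EllipticCurves.Kriz2021

/-! ### §1. `Ξ_p(w, χ̌) ≠ 0` on `Σ` in weight `2` (Hasse) -/

/-- **`Ξ_p` never vanishes on `Σ` in weight `2`** (ramified case): for `x` with `‖x‖ = 1/p`
(`= ‖χ⁻¹(𝔭)‖`, `|χ(𝔭)| = N𝔭 = p`) and `‖a‖ < p + 1` (Hasse: `|a_p(E)| ≤ 2√p`), `Ξ ≠ 0`:
else `a x p = p + 1` and `‖a‖ = p + 1`. [cite: Kriz2021, Prop. 8.11 (p0214)] [cite: SilvermanAEC2009, Thm. V.1.1 (Hasse)] -/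
theorem xiRamified_ne_zero {p : ℕ} (hp : 2 ≤ p) {a x : ℂ} (hx : ‖x‖ = 1 / p) (ha : ‖a‖ < p + 1) :
    xiRamified p a x ≠ 0 := by
  have hp0 : (p : ℂ) ≠ 0 := by exact_mod_cast (show p ≠ 0 by omega)
  have hp1 : (p : ℂ) - 1 ≠ 0 := sub_ne_zero.mpr (by exact_mod_cast (show p ≠ 1 by omega))
  intro h
  unfold xiRamified at h
  -- clear denominators: `a * x * p = p + 1`
  have key : a * x * (p : ℂ) = (p : ℂ) + 1 := by
    have h1 : ((p : ℂ) ^ 2 - a * x * (p : ℂ) * ((p : ℂ) - 1) - 1) = 0 := by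
      have := congrArg (· * (p : ℂ) ^ 2) h
      simp only [zero_mul] at this
      rw [← this]
      field_simp
    have h2 : ((p : ℂ) - 1) * ((p : ℂ) + 1 - a * x * (p : ℂ)) = 0 := by
      linear_combination h1
    rcases mul_eq_zero.mp h2 with h3 | h3
    · exact absurd h3 hp1
    · linear_combination -h3
  have hn := congrArg (‖·‖) key
  simp only [norm_mul, hx, Complex.norm_natCast] at hn
  rw [one_div, mul_assoc, inv_mul_cancel₀ (by exact_mod_cast (show (p : ℝ) ≠ 0 by positivity)),
    mul_one] at hn
  have : ‖(p : ℂ) + 1‖ = (p : ℝ) + 1 := by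
    rw [show (p : ℂ) + 1 = ((p + 1 : ℕ) : ℂ) by push_cast; ring, Complex.norm_natCast]
    push_cast; ring
  rw [this] at hn
  linarith

/-- **`Ξ_p` never vanishes on `Σ` in weight `2`** (inert case): for `‖x‖ = 1/p²` (`= ‖χ⁻¹(p)‖`) and
`‖a‖ < p + 1`, `Ξ ≠ 0`: else `a² x p² = (p+1)²` and `‖a‖ = p + 1`.
[cite: Kriz2021, Prop. 8.11 (p0214)] [cite: SilvermanAEC2009, Thm. V.1.1 (Hasse)] -/
theorem xiInert_ne_zero {p : ℕ} (hp : 2 ≤ p) {a x : ℂ} (hx : ‖x‖ = 1 / (p : ℝ) ^ 2)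
    (ha : ‖a‖ < p + 1) : xiInert p a x ≠ 0 := by
  have hp0 : (p : ℂ) ≠ 0 := by exact_mod_cast (show p ≠ 0 by omega)
  have hp1 : (p : ℂ) - 1 ≠ 0 := sub_ne_zero.mpr (by exact_mod_cast (show p ≠ 1 by omega))
  have hp2 : (p : ℂ) + 1 ≠ 0 := by exact_mod_cast Nat.succ_ne_zero p
  intro h
  unfold xiInert at h
  have key : a ^ 2 * x * (p : ℂ) ^ 2 = ((p : ℂ) + 1) ^ 2 := by
    have h1 : ((p : ℂ) ^ 2 * ((p : ℂ) + 1) - a ^ 2 * x * (p : ℂ) ^ 2 * ((p : ℂ) - 1)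
        - ((p : ℂ) + 1)) = 0 := by
      have := congrArg (· * ((p : ℂ) ^ 2 * ((p : ℂ) + 1))) h
      simp only [zero_mul] at this
      rw [← this]
      field_simp
    have h2 : ((p : ℂ) - 1) * (((p : ℂ) + 1) ^ 2 - a ^ 2 * x * (p : ℂ) ^ 2) = 0 := by
      linear_combination h1
    rcases mul_eq_zero.mp h2 with h3 | h3
    · exact absurd h3 hp1
    · linear_combination -h3
  have hn := congrArg (‖·‖) key
  simp only [norm_mul, norm_pow, hx, Complex.norm_natCast] at hn
  rw [one_div, mul_assoc, inv_mul_cancel₀ (by positivity), mul_one] at hn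
  have h3 : ‖(p : ℂ) + 1‖ = (p : ℝ) + 1 := by
    rw [show (p : ℂ) + 1 = ((p + 1 : ℕ) : ℂ) by push_cast; ring, Complex.norm_natCast]
    push_cast; ring
  rw [h3] at hn
  have h4 : ‖a‖ = (p : ℝ) + 1 := by
    have h5 : 0 ≤ ‖a‖ := norm_nonneg a
    have h6 : (0 : ℝ) ≤ p + 1 := by positivity
    nlinarith [hn, h5, h6, sq_nonneg (‖a‖ - (p + 1))]
  linarith

/-- Hasse's bound implies the hypothesis of the two lemmas above: `|a| ≤ 2√p ⟹ |a| < p + 1` for `p ≥ 1`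
(`(p+1)² − 4p = (p−1)² ≥ 0`, with equality excluded since `2√p` is attained only if… in any case
`2√p < p + 1` unless `p = 1`). [cite: SilvermanAEC2009, Thm. V.1.1 (Hasse)] -/
theorem lt_succ_of_le_two_mul_sqrt {p : ℕ} (hp : 2 ≤ p) {t : ℝ} (h : t ≤ 2 * Real.sqrt p) :
    t < p + 1 := by
  have hp' : (2 : ℝ) ≤ p := by exact_mod_cast hp
  have hs : 0 ≤ Real.sqrt p := Real.sqrt_nonneg _
  have hsq : Real.sqrt p ^ 2 = p := Real.sq_sqrt (by positivity)
  nlinarith [sq_nonneg (Real.sqrt p - 1), hsq, hs]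

/-! ### §2. The `p = 2` ramified specialisation (the consumer's shape: `4 ∣ d_K`) -/

variable {K : Type} [Field K] [NumberField K] {N : ℕ}


/-- **`4 ∣ d_K ⟹` exactly one prime of `𝓞 K` above `2`** (`2` ramified; Dedekind–Kummer with an
integral basis `(1, ω)`, `ω² = m + tω`, `d_K = t² + 4m`: `4 ∣ d_K` forces `t` even, and `X² − tX − m ≡ X²`
or `(X − 1)²` (mod `2`) has ONE irreducible factor). [cite: Marcus2018, Ch. 3 Thm. 25 (decomposition law at 2, ramified case)] -/
theorem ncard_primesOver_two_eq_one_of_four_dvd_discr (h2 : Module.finrank ℚ K = 2)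
    (h4 : (4 : ℤ) ∣ NumberField.discr K) :
    ((Ideal.span {(2 : ℤ)}).primesOver (𝓞 K)).ncard = 1 := by
  obtain ⟨b, hb⟩ := exists_basis_zero_eq_one h2
  haveI := Fact.mk Nat.prime_two
  have hc := ncard_primesOver_eq_card_toFinset b hb (p := 2)
  simp only [Nat.cast_ofNat] at hc
  rw [hc]
  rw [discr_eq_sq_add_four_mul b hb] at h4
  generalize b.repr (b 1 * b 1) 1 = t at h4 ⊢
  generalize b.repr (b 1 * b 1) 0 = m at h4 ⊢
  have h20 : (2 : ZMod 2) = 0 := rfl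
  -- `t` is even: `(2k+1)² + 4m = 4(k² + k + m) + 1` is not divisible by `4`
  obtain ⟨k, rfl | rfl⟩ := Int.even_or_odd' t
  swap
  · exfalso
    have : (2 * k + 1) ^ 2 + 4 * m = 4 * (k ^ 2 + k + m) + 1 := by ring
    rw [this] at h4
    omega
  have ht : ((2 * k : ℤ) : ZMod 2) = 0 := by
    rw [Int.cast_mul, Int.cast_ofNat, h20, zero_mul]
  rw [ht]
  obtain ⟨j, rfl | rfl⟩ := Int.even_or_odd' m
  · have hm : ((2 * j : ℤ) : ZMod 2) = 0 := by rw [Int.cast_mul, Int.cast_ofNat, h20, zero_mul]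
    rw [hm]
    exact card_toFinset_normalizedFactors_X_sq_sub_zero_zero
  · have hm : ((2 * j + 1 : ℤ) : ZMod 2) = 1 := by
      rw [Int.cast_add, Int.cast_mul, Int.cast_ofNat, h20, zero_mul, zero_add, Int.cast_one]
    rw [hm]
    exact card_toFinset_normalizedFactors_X_sq_sub_zero_one_zmod_two

/-- **The fact at `p = 2` RAMIFIED, in the consumer's shape.** For the newform `f` of `W`, `N = N_W` odd
with `4 ≤ N`, `K` imaginary quadratic with `4 ∣ d_K` (so `2` is ramified: one prime above `2`) and every
`ℓ ∣ N` split in `K`, the named fact supplies a frame `𝓛` for `𝓛_{2,α}(f/K, ·)` (`q = 8`, `b = 3`). A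
specialisation; nothing new is asserted. [cite: Kriz2021, Thm. 9.10 (p0227) and Thm. 1.1 at p = 2 (p0032 L33–37)] -/
theorem thm910_exists_anticyclotomicLFunction.two_of_four_dvd_discr [Fact (Nat.Prime 2)]
    (h : thm910_exists_anticyclotomicLFunction) (W : WeierstrassCurve ℚ) [W.IsElliptic] [NeZero N]
    (f : CuspForm (CongruenceSubgroup.Gamma0 N) 2) (hf : IsNewformOf W f) (hN : W.conductorNorm ℤ = N)
    (h4N : 4 ≤ N) (hodd : ¬ 2 ∣ N) (hK : IsImaginaryQuadratic K) (h4 : (4 : ℤ) ∣ NumberField.discr K)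
    (hH : SatisfiesHeegnerHypothesis N K) :
    ∃ 𝓛 : HeckeCharacter K → ℂ_[2], IsAnticyclotomicLFunction N W f 2 K 𝓛 :=
  h W f hf hN h4N 2 hodd K hK
    (by simpa only [Nat.cast_ofNat] using ncard_primesOver_two_eq_one_of_four_dvd_discr hK.1 h4) hH


end Literature.NumberTheory.EllipticCurves.Kriz2021

end
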